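import Summits.CriticalPhenomena.Ising3DConformalLimit.Theorems.EnergyNotSigmaSquaredGapForcesFarMergingRpSchwarzOnePinch
import Summits.CriticalPhenomena.Ising3DConformalLimit.Theorems.EnergyNotSigmaSquaredGapForcesFarMergingGapGivesOnePinchLaw
import Summits.CriticalPhenomena.Ising3DConformalLimit.Theorems.EnergyNotSigmaSquaredGapForcesFarMergingRegularReading
import HarnessLib.Audit

/-!
# Line `rp-schwarz-single-pinch` — crux `EnergyNotSigmaSquared.GapForcesFarMerging` (stmt-CriticalPhenomena-4468)
# Lead skeleton (seat c3, 2026-08-16), v2: CLOSED MODULO T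

Over the reviewed Defs module `Theorems/EnergyNotSigmaSquaredGapForcesFarMergingRPSchwarzDefs.lean` (p124955:
currencies `RPSchwarzOnePinch`, `OnePinchLaw`, `OnePinchLawOnRegularScales`, `DyadicSplitMerging`; vocabulary
`pairTrunc`, `dy`, `thinShape`; composition certificate `gapForcesFarMerging_of_onePinchLaw_transfer`).

CRUX (by name): `GapForcesFarMerging := EnergyGapPowerLaw → FarMerging` (`Negative.SoftShapes.crux_iff`).

THE LINE (planner `planner-cruxplan-stmt-CriticalPhenomena-4468-rp-schwarz-single-pi-0`, statements unchanged;
prose in the tree copy `Cruxes/GapForcesFarMerging/Lines/rp-schwarz-single-pinch.lean`):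
* A `stub_rpSchwarzOnePinch : RPSchwarzOnePinch` — the RP Gram minor with the energy row across EVERY mirror
  `x₀ ↦ t − x₀` (site and bond planes) — LANDED p125646 (`…RpSchwarzOnePinch.lean`, general `rp_gram_mirror`);
* B `stub_gapGivesOnePinchLaw : RPSchwarzOnePinch → EnergyGapPowerLaw → OnePinchLaw` — GAP un-pinched at the far
  end: `⟨σ₀σ_{e₂} ; σ_{te₁+p}σ_{te₁+q}⟩ ≤ C t^{-κ/2} G(te₁)²` for ALL `t ≥ 1` and ALL in-plane targets — LANDED p125842
  (`…GapGivesOnePinchLaw.lean`);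
* R `stub_regularReading : OnePinchLaw → OnePinchLawOnRegularScales` — cross-Wick reading on the unboundedly many
  doubling scales — LANDED p126032 (`…RegularReading.lean`);
* T `stub_onePinchForcesSplitMerging : OnePinchLaw → OnePinchLawOnRegularScales → DyadicSplitMerging` — the transfer
  (HARDEST, lead): OPEN; it is the crux's common core (un-pinning of the NEAR end = separation + ratio-Harnack for
  sourced critical currents on ℤ³), not soft (`oneEndedGapForcesFarMerging_false_without_model`) and not reachable
  through reflection positivity (RP–GFF barrier, `Lines/rp_schwarz_single_pinch.dead.md` §3).

Sorries: only `stub_onePinchForcesSplitMerging`.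
-/

noncomputable section

namespace Summit.CriticalPhenomena.Ising3DConformalLimit.Cruxes.GapForcesFarMerging.RPSchwarzSinglePinch

open Literature.Probability.LatticeModels
open Summit.CriticalPhenomena.Ising3DConformalLimit.Theses.EnergyNotSigmaSquared
open Summit.CriticalPhenomena.Ising3DConformalLimit.GapForcesFarMergingRPSchwarz

/-! ## Stub T — the transfer (hardest; open; lead) -/

/-- Registered stub T: the one-pinch power law (all scales, RP normalisation, and its avoidance-ready form on
unboundedly many regular dyadic scales) forces split-pinch far merging along a thin shape of a finite menu. -/
theorem stub_onePinchForcesSplitMerging :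
    OnePinchLaw → OnePinchLawOnRegularScales → DyadicSplitMerging := by
  sorry

/-! ### Registered-stub alias (hypothesis head matched by name by the skeleton audit) -/
namespace Registered

/-- Statement of registered stub T. -/
abbrev stub_onePinchForcesSplitMerging : Prop :=
  OnePinchLaw → OnePinchLawOnRegularScales → DyadicSplitMerging

end Registered

/-- **The skeleton closes the crux modulo the one registered open stub T**: GAP is fed to the LANDED B (with the
LANDED A), read on regular scales by the LANDED R, transferred by T, and the shape is fixed by pigeonhole inside
the Defs certificate — `GapForcesFarMerging` BY NAME. -/
theorem GapForcesFarMerging_of (hT : Registered.stub_onePinchForcesSplitMerging) : GapForcesFarMerging :=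
  gapForcesFarMerging_of_onePinchLaw_transfer (stub_gapGivesOnePinchLaw stub_rpSchwarzOnePinch)
    stub_regularReading hT

/-- How the closed proof is obtained once T lands (an `example`, so that `GapForcesFarMerging_of` is the only
theorem of this file concluding the crux). -/
example : GapForcesFarMerging := GapForcesFarMerging_of stub_onePinchForcesSplitMerging

end Summit.CriticalPhenomena.Ising3DConformalLimit.Cruxes.GapForcesFarMerging.RPSchwarzSinglePinch

end
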